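import Mathlib
import HarnessLib
import Summits.Ventures.LatticeQCDFlow.Scoring.SelfNormalisedReweightingStudentisedCLT
import Summits.Ventures.LatticeQCDFlow.Scoring.IndependentSumLimit
import Summits.Ventures.LatticeQCDFlow.Scoring.GaussianCombinationLimit

/-!
# The A-versus-B agreement test with UNEQUAL SAMPLE SIZES: for two independent codes with
# `n_A = n` and `n_B = mₙ → ∞` draws (any ratio, not necessarily convergent), the studentised
# difference `(Sₙ^A − S_{mₙ}^B)/√(V̂ₙ^A + V̂_{mₙ}^B)` converges in distribution to `N(0, 1)`

HONEST FRAMING: exact (Metropolis-corrected) sampling algorithms for lattice gauge theory;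
figures of merit are autocorrelation/cost numbers at stated couplings and volumes; no
continuum-physics claim.

Venture `LatticeQCDFlow` (cell pub-lqcd), topic `Scoring`; FANOUT row 4 (`s0-u1-b`, rung S0-B:
two independent codes compared column by column; acceptance criterion "A vs B within
`1σ_comb`").  `Scoring/TwoCodeAgreementCLT` proved the equal-sample-size case; the two arms of
row 4 print different numbers of draws.  This file removes the restriction, in two layers.
(1) **`twoSample_agreement_clt`** — ABSTRACT: any two columns `S^A, S^B` of two independent
codes with one-code central limit theorems `√n(Sₙ^X − a) ⇒ N(0, s_X)`, `s_X > 0`, and strongly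
consistent printed squared standard errors `n·V̂ₙ^X → s_X` a.s.; for ANY `mₙ → ∞`, on the product
space `P_A ⊗ P_B`, `(Sₙ^A − S_{mₙ}^B)/√(V̂ₙ^A + V̂_{mₙ}^B) ⇒ Z ∼ N(0, 1)`.  Proof: the statistic is
`(aₙUₙ − bₙW_{mₙ})/√ρₙ` with `Uₙ = √n(Sₙ^A − a)`, `Wₙ = √mₙ(S_{mₙ}^B − a)` independent on the
product space (`Scoring/IndependentSumLimit`), `aₙ = √mₙ/√Dₙ`, `bₙ = √n/√Dₙ`,
`Dₙ = s_A mₙ + s_B n`, so `s_A aₙ² + s_B bₙ² = 1` and the Gaussian combination lemma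
(`Scoring/GaussianCombinationLimit`, resting on the uniform convergence of characteristic
functions along bounded arguments, `Scoring/CharFunArgumentContinuity`) gives
`aₙUₙ − bₙW_{mₙ} ⇒ N(0, 1)` with NO condition on `n/mₙ`; the pooled-variance ratio
`ρₙ = (V̂ₙ^A + V̂_{mₙ}^B)/(s_A/n + s_B/mₙ) → 1` a.s. whatever the weights
(`tendsto_weightedRatio_one`); Slutsky.  (2) **`twoCode_agreement_clt_unequal`** — the
observable column of the printed card (self-normalised estimates and their printed error bars,
`Scoring/SelfNormalisedReweightingCLT`, `Scoring/SelfNormalisedErrorBarConsistency`).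
NEW WORK of the cell; no definition; nothing cited as a fact (the two-sample z-test is folklore).

## Content

* `twoSample_studentise_eq` — the algebra for `n, m ≥ 1`;
* **`twoSample_agreement_clt`** — the abstract two-sample test, any `mₙ → ∞`;
* **`twoCode_agreement_clt_unequal`** — the printed observable column, sizes `n` and `mₙ`.

NOT CLAIMED: degenerate columns (`s_A = 0` or `s_B = 0`: with unequal sizes the pooled ratio
can fail); dependent codes; random sample sizes; any number of ours re-scored.
-/

noncomputable section

namespace Summit.Ventures.LatticeQCDFlow.Scoring.CardConsistency

open MeasureTheory ProbabilityTheory Finset Real Filter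
open scoped Topology Function

/-! ## §1 Algebra -/

section Algebra

/-- For `n, m ≥ 1`, `s_A, s_B > 0`, `D = s_A m + s_B n`:
`(S^A − S^B)/√(V^A + V^B) = ((√m/√D)·√n(S^A − a) − (√n/√D)·√m(S^B − a)) / √ρ` with
`ρ = (nV^A·n⁻¹ + mV^B·m⁻¹)/(s_A n⁻¹ + s_B m⁻¹)`. [ours] -/
theorem twoSample_studentise_eq {n m : ℕ} (hn : 1 ≤ n) (hm : 1 ≤ m) {sA sB : ℝ} (hsA : 0 < sA)
    (hsB : 0 < sB) (SA SB a VA VB : ℝ) :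
    (SA - SB) / Real.sqrt (VA + VB)
      = (Real.sqrt m / Real.sqrt (sA * m + sB * n) * (Real.sqrt n * (SA - a))
          - Real.sqrt n / Real.sqrt (sA * m + sB * n) * (Real.sqrt m * (SB - a)))
        / Real.sqrt (((n : ℝ) * VA * (n : ℝ)⁻¹ + (m : ℝ) * VB * (m : ℝ)⁻¹)
            / (sA * (n : ℝ)⁻¹ + sB * (m : ℝ)⁻¹)) := by
  have hn0 : (0 : ℝ) < n := by exact_mod_cast hn
  have hm0 : (0 : ℝ) < m := by exact_mod_cast hm
  have hD : 0 < sA * m + sB * n := by positivity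
  have e1 : (n : ℝ) * VA * (n : ℝ)⁻¹ + (m : ℝ) * VB * (m : ℝ)⁻¹ = VA + VB := by
    field_simp
  have e2 : sA * (n : ℝ)⁻¹ + sB * (m : ℝ)⁻¹ = (sA * m + sB * n) / (n * m) := by
    field_simp
  have e3 : Real.sqrt m / Real.sqrt (sA * m + sB * n) * (Real.sqrt n * (SA - a))
        - Real.sqrt n / Real.sqrt (sA * m + sB * n) * (Real.sqrt m * (SB - a))
      = Real.sqrt n * Real.sqrt m / Real.sqrt (sA * m + sB * n) * (SA - SB) := by
    have hDs : Real.sqrt (sA * m + sB * n) ≠ 0 := (Real.sqrt_pos.2 hD).ne'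
    field_simp
    ring
  have e4 : Real.sqrt ((VA + VB) / ((sA * m + sB * n) / (n * m)))
      = Real.sqrt (VA + VB) * (Real.sqrt n * Real.sqrt m) / Real.sqrt (sA * m + sB * n) := by
    rw [Real.sqrt_div' _ (div_nonneg hD.le (mul_nonneg hn0.le hm0.le)),
      Real.sqrt_div hD.le, Real.sqrt_mul hn0.le]
    have hDs : Real.sqrt (sA * m + sB * n) ≠ 0 := (Real.sqrt_pos.2 hD).ne'
    have hns : Real.sqrt n ≠ 0 := (Real.sqrt_pos.2 hn0).ne'
    have hms : Real.sqrt m ≠ 0 := (Real.sqrt_pos.2 hm0).ne'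
    field_simp
  rw [e1, e2, e3, e4]
  have hDs : Real.sqrt (sA * m + sB * n) ≠ 0 := (Real.sqrt_pos.2 hD).ne'
  have hns : Real.sqrt n ≠ 0 := (Real.sqrt_pos.2 hn0).ne'
  have hms : Real.sqrt m ≠ 0 := (Real.sqrt_pos.2 hm0).ne'
  rcases eq_or_ne (Real.sqrt (VA + VB)) 0 with hV | hV
  · rw [hV, zero_mul, zero_div, div_zero, div_zero]
  · field_simp

end Algebra

/-! ## §2 The abstract two-sample test -/

section Abstract

variable {ΩA : Type*} [MeasurableSpace ΩA] {PA : Measure ΩA} [IsProbabilityMeasure PA]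
variable {ΩB : Type*} [MeasurableSpace ΩB] {PB : Measure ΩB} [IsProbabilityMeasure PB]
variable {Ω' : Type*} [MeasurableSpace Ω'] {P' : Measure Ω'} [IsProbabilityMeasure P']

/-- **THE TWO-SAMPLE AGREEMENT TEST WITH UNEQUAL SAMPLE SIZES IS ASYMPTOTICALLY EXACT.**  Two
independent codes on `(Ω_A, P_A)` and `(Ω_B, P_B)` print, after `n` draws, a column `Sₙ^X`
(measurable) and its squared standard error `V̂ₙ^X` (measurable), `X ∈ {A, B}`, with one-code
central limit theorems `√n(Sₙ^X − a) ⇒ Z_X ∼ N(0, s_X)`, `s_X > 0` (the SAME centre `a`), and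
strongly consistent error bars `n·V̂ₙ^X → s_X` almost surely.  Let code `B` print `mₙ` draws
against code `A`'s `n`, with `mₙ → ∞` and NO condition on `n/mₙ`; `Z ∼ N(0, 1)`.  Then on the
product space `P_A ⊗ P_B`:
`(Sₙ^A − S_{mₙ}^B)/√(V̂ₙ^A + V̂_{mₙ}^B) ⇒ Z`. [ours] -/
theorem twoSample_agreement_clt {SA VA : ℕ → ΩA → ℝ} {SB VB : ℕ → ΩB → ℝ} {a sA sB : ℝ}
    {ZA ZB Z : Ω' → ℝ} (hsA : 0 < sA) (hsB : 0 < sB) (hSAm : ∀ n, Measurable (SA n))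
    (hVAm : ∀ n, Measurable (VA n)) (hSBm : ∀ n, Measurable (SB n))
    (hVBm : ∀ n, Measurable (VB n))
    (hcltA : TendstoInDistribution (fun (n : ℕ) ω => Real.sqrt n * (SA n ω - a)) atTop ZA
      (fun _ => PA) P') (hZA : HasLaw ZA (gaussianReal 0 sA.toNNReal) P')
    (hcltB : TendstoInDistribution (fun (n : ℕ) ω => Real.sqrt n * (SB n ω - a)) atTop ZB
      (fun _ => PB) P') (hZB : HasLaw ZB (gaussianReal 0 sB.toNNReal) P')
    (hVA : ∀ᵐ ω ∂PA, Tendsto (fun n : ℕ => (n : ℝ) * VA n ω) atTop (𝓝 sA))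
    (hVB : ∀ᵐ ω ∂PB, Tendsto (fun n : ℕ => (n : ℝ) * VB n ω) atTop (𝓝 sB))
    {m : ℕ → ℕ} (hm : Tendsto m atTop atTop) (hZ : HasLaw Z (gaussianReal 0 1) P') :
    TendstoInDistribution (fun (n : ℕ) (ω : ΩA × ΩB) =>
        (SA n ω.1 - SB (m n) ω.2) / Real.sqrt (VA n ω.1 + VB (m n) ω.2))
      atTop Z (fun _ => PA.prod PB) P' := by
  -- Step 1: the two centred, scaled columns on the product space, code `B` along `mₙ`
  have hU : TendstoInDistribution (fun (n : ℕ) (ω : ΩA × ΩB) => Real.sqrt n * (SA n ω.1 - a))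
      atTop ZA (fun _ => PA.prod PB) P' :=
    tendstoInDistribution_comp_fst hcltA
  have hW : TendstoInDistribution
      (fun (n : ℕ) (ω : ΩA × ΩB) => Real.sqrt (m n : ℕ) * (SB (m n) ω.2 - a))
      atTop ZB (fun _ => PA.prod PB) P' :=
    tendstoInDistribution_comp_snd (tendstoInDistribution_comp_tendsto hcltB hm)
  have hUW : ∀ n : ℕ, IndepFun (fun ω : ΩA × ΩB => Real.sqrt n * (SA n ω.1 - a))
      (fun ω : ΩA × ΩB => Real.sqrt (m n : ℕ) * (SB (m n) ω.2 - a)) (PA.prod PB) := fun n =>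
    indepFun_prod₀ (((hSAm n).sub_const a).const_mul _).aemeasurable
      (((hSBm (m n)).sub_const a).const_mul _).aemeasurable
  -- Step 2: the coefficients `aₙ = √mₙ/√Dₙ`, `bₙ = √n/√Dₙ`, `Dₙ = s_A mₙ + s_B n`
  have hαβ : ∀ᶠ n : ℕ in atTop,
      sA * (Real.sqrt (m n : ℕ) / Real.sqrt (sA * (m n : ℕ) + sB * n)) ^ 2
        + sB * (Real.sqrt n / Real.sqrt (sA * (m n : ℕ) + sB * n)) ^ 2 = 1 := by
    filter_upwards [eventually_ge_atTop 1] with n hn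
    have hn0 : (0 : ℝ) < n := by exact_mod_cast hn
    have hD : 0 < sA * (m n : ℕ) + sB * n :=
      add_pos_of_nonneg_of_pos (mul_nonneg hsA.le (Nat.cast_nonneg _)) (mul_pos hsB hn0)
    rw [div_pow, div_pow, Real.sq_sqrt (Nat.cast_nonneg _), Real.sq_sqrt hn0.le,
      Real.sq_sqrt hD.le]
    field_simp
  have hL := tendstoInDistribution_gaussianCombination hsA hsB hU hZA hW hZB hUW hαβ hZ
  -- Step 3: the pooled-variance ratio `ρₙ → 1` almost surely on the product space
  have hρae : ∀ᵐ ω ∂PA.prod PB, Tendsto (fun n : ℕ =>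
      ((n : ℝ) * VA n ω.1 * (n : ℝ)⁻¹ + ((m n : ℕ) : ℝ) * VB (m n) ω.2 * ((m n : ℕ) : ℝ)⁻¹)
        / (sA * (n : ℝ)⁻¹ + sB * ((m n : ℕ) : ℝ)⁻¹)) atTop (𝓝 1) := by
    have hA' := (Measure.quasiMeasurePreserving_fst (μ := PA) (ν := PB)).ae hVA
    have hB' := (Measure.quasiMeasurePreserving_snd (μ := PA) (ν := PB)).ae hVB
    have hpq : ∀ᶠ n : ℕ in atTop, 0 ≤ (n : ℝ)⁻¹ ∧ 0 ≤ ((m n : ℕ) : ℝ)⁻¹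
        ∧ 0 < (n : ℝ)⁻¹ + ((m n : ℕ) : ℝ)⁻¹ := by
      filter_upwards [eventually_ge_atTop 1] with n hn
      have hn0 : (0 : ℝ) < n := by exact_mod_cast hn
      exact ⟨(inv_pos.2 hn0).le, inv_nonneg.2 (Nat.cast_nonneg _),
        add_pos_of_pos_of_nonneg (inv_pos.2 hn0) (inv_nonneg.2 (Nat.cast_nonneg _))⟩
    filter_upwards [hA', hB'] with ω hA hB
    exact tendsto_weightedRatio_one hsA hsB hA (hB.comp hm) hpq
  have hρm : ∀ n : ℕ, Measurable fun ω : ΩA × ΩB =>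
      ((n : ℝ) * VA n ω.1 * (n : ℝ)⁻¹ + ((m n : ℕ) : ℝ) * VB (m n) ω.2 * ((m n : ℕ) : ℝ)⁻¹)
        / (sA * (n : ℝ)⁻¹ + sB * ((m n : ℕ) : ℝ)⁻¹) := fun n =>
    (((((hVAm n).comp measurable_fst).const_mul _).mul_const _).add
      ((((hVBm (m n)).comp measurable_snd).const_mul _).mul_const _)).div_const _
  have hρ := tendstoInMeasure_of_tendsto_ae (fun n => (hρm n).aestronglyMeasurable) hρae
  -- Step 4: Slutsky with `g(x, r) = x/√(max(r, 1/2))`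
  have hgc : Continuous fun z : ℝ × ℝ => z.1 / Real.sqrt (max z.2 (1 / 2)) :=
    continuous_fst.div (continuous_snd.max continuous_const).sqrt fun z =>
      (Real.sqrt_pos.2 (lt_max_of_lt_right one_half_pos)).ne'
  have hsl := hL.continuous_comp_prodMk_of_tendstoInMeasure_const hgc hρ
    (fun n => (hρm n).aemeasurable)
  have elim : (fun ω' => Z ω' / Real.sqrt (max (1 : ℝ) (1 / 2))) = Z := by
    funext ω'
    rw [max_eq_left (by norm_num), Real.sqrt_one, div_one]
  rw [elim] at hsl
  -- Step 5: the printed statistic agrees eventually, almost surely, with the Slutsky statistic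
  have hTm : ∀ n : ℕ, Measurable fun ω : ΩA × ΩB =>
      (SA n ω.1 - SB (m n) ω.2) / Real.sqrt (VA n ω.1 + VB (m n) ω.2) := fun n =>
    (((hSAm n).comp measurable_fst).sub ((hSBm (m n)).comp measurable_snd)).div
      (((hVAm n).comp measurable_fst).add ((hVBm (m n)).comp measurable_snd)).sqrt
  have hLm : ∀ n : ℕ, Measurable fun ω : ΩA × ΩB =>
      Real.sqrt (m n : ℕ) / Real.sqrt (sA * (m n : ℕ) + sB * n) * (Real.sqrt n * (SA n ω.1 - a))
        - Real.sqrt n / Real.sqrt (sA * (m n : ℕ) + sB * n)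
          * (Real.sqrt (m n : ℕ) * (SB (m n) ω.2 - a)) := fun n =>
    (((((hSAm n).comp measurable_fst).sub_const a).const_mul _).const_mul _).sub
      (((((hSBm (m n)).comp measurable_snd).sub_const a).const_mul _).const_mul _)
  refine tendstoInDistribution_of_tendstoInMeasure_sub _ _ hsl ?_ (fun n => (hTm n).aemeasurable)
  refine tendstoInMeasure_of_tendsto_ae
    (fun n => ((hTm n).sub ((hLm n).div ((hρm n).max measurable_const).sqrt)).aestronglyMeasurable)
    ?_
  filter_upwards [hρae] with ω hρω
  refine (tendsto_const_nhds (x := (0 : ℝ))).congr' ?_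
  filter_upwards [hρω.eventually_const_lt one_half_lt_one, eventually_ge_atTop 1,
    hm.eventually (eventually_ge_atTop 1)] with n hρn hn1 hm1
  rw [Pi.sub_apply, Pi.sub_apply, max_eq_left hρn.le,
    twoSample_studentise_eq hn1 hm1 hsA hsB (SA n ω.1) (SB (m n) ω.2) a (VA n ω.1)
      (VB (m n) ω.2), sub_self]

end Abstract

/-! ## §3 The printed observable column -/

section Printed

variable {ΩA : Type*} [MeasurableSpace ΩA] {PA : Measure ΩA} [IsProbabilityMeasure PA]
variable {ΩB : Type*} [MeasurableSpace ΩB] {PB : Measure ΩB} [IsProbabilityMeasure PB]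
variable {Ω' : Type*} [MeasurableSpace Ω'] {P' : Measure Ω'} [IsProbabilityMeasure P']
variable {X : Type*} [MeasurableSpace X] {μ : Measure X} {p q q' O : X → ℝ}
variable {y : ℕ → ΩA → X} {y' : ℕ → ΩB → X} {Z : Ω' → ℝ}

/-- **THE TWO-CODE AGREEMENT TEST WITH UNEQUAL SAMPLE SIZES.**  Codes `A` (stream `yᵢ` on
`(Ω_A, P_A)`, model `q_A > 0`, weights `w̃ = c_A·p/q_A`, `c_A ≠ 0`, `n` draws) and `B`
(likewise with `q_B`, `c_B`, `mₙ` draws, `mₙ → ∞`, any ratio `n/mₙ`) sample ONE normalised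
target `p` and print, for a measurable observable `O` with the second-moment hypotheses of
`Scoring/SelfNormalisedReweightingCLT` under both models and POSITIVE sandwich variances
`σ_A², σ_B²`, the self-normalised estimates of `E_p O` and their squared standard errors;
`Z ∼ N(0, 1)`.  Then on `P_A ⊗ P_B`:
`(Sₙ^A − S_{mₙ}^B)/√(V̂ₙ^A + V̂_{mₙ}^B) ⇒ Z`. [ours] -/
theorem twoCode_agreement_clt_unequal (hym : ∀ j, Measurable (y j)) (hind : iIndepFun y PA)
    (hlaw : ∀ j, Measure.map (y j) PA = μ.withDensity fun z => ENNReal.ofReal (q z))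
    (hym' : ∀ j, Measurable (y' j)) (hind' : iIndepFun y' PB)
    (hlaw' : ∀ j, Measure.map (y' j) PB = μ.withDensity fun z => ENNReal.ofReal (q' z))
    (hpm : Measurable p) (hpi : Integrable p μ) (hp1 : ∫ z, p z ∂μ = 1) (hOm : Measurable O)
    (hpO : Integrable (fun z => p z * O z) μ)
    (hq0 : ∀ z, 0 < q z) (hqm : Measurable q) (hM2i : Integrable (fun z => p z ^ 2 / q z) μ)
    (hT1i : Integrable (fun z => p z ^ 2 / q z * O z) μ)
    (hT2i : Integrable (fun z => p z ^ 2 / q z * O z ^ 2) μ)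
    (hq0' : ∀ z, 0 < q' z) (hqm' : Measurable q') (hM2i' : Integrable (fun z => p z ^ 2 / q' z) μ)
    (hT1i' : Integrable (fun z => p z ^ 2 / q' z * O z) μ)
    (hT2i' : Integrable (fun z => p z ^ 2 / q' z * O z ^ 2) μ)
    (hsA : 0 < ∫ z, p z ^ 2 / q z * (O z - ∫ x, p x * O x ∂μ) ^ 2 ∂μ)
    (hsB : 0 < ∫ z, p z ^ 2 / q' z * (O z - ∫ x, p x * O x ∂μ) ^ 2 ∂μ)
    {wt wt' : X → ℝ} {c c' : ℝ} (hc : c ≠ 0) (hwt : ∀ z, wt z = c * (p z / q z)) (hc' : c' ≠ 0)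
    (hwt' : ∀ z, wt' z = c' * (p z / q' z)) {m : ℕ → ℕ} (hm : Tendsto m atTop atTop)
    (hZ : HasLaw Z (gaussianReal 0 1) P') :
    TendstoInDistribution (fun (n : ℕ) (ω : ΩA × ΩB) =>
        ((∑ i ∈ range n, wt (y i ω.1) * O (y i ω.1)) / (∑ i ∈ range n, wt (y i ω.1))
          - (∑ i ∈ range (m n), wt' (y' i ω.2) * O (y' i ω.2))
            / (∑ i ∈ range (m n), wt' (y' i ω.2)))
        / Real.sqrt
          ((∑ i ∈ range n, wt (y i ω.1) ^ 2 * (O (y i ω.1)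
              - (∑ j ∈ range n, wt (y j ω.1) * O (y j ω.1)) / (∑ j ∈ range n, wt (y j ω.1))) ^ 2)
            / (∑ i ∈ range n, wt (y i ω.1)) ^ 2
          + (∑ i ∈ range (m n), wt' (y' i ω.2) ^ 2 * (O (y' i ω.2)
              - (∑ j ∈ range (m n), wt' (y' j ω.2) * O (y' j ω.2))
                / (∑ j ∈ range (m n), wt' (y' j ω.2))) ^ 2)
            / (∑ i ∈ range (m n), wt' (y' i ω.2)) ^ 2))
      atTop Z (fun _ => PA.prod PB) P' := by
  have hsA0 := hsA.le
  have hsB0 := hsB.le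
  -- the one-code central limit theorems with limits `√s_A·Z`, `√s_B·Z`
  have hcltA := selfNormReweighting_clt (P' := P') hym hind hlaw hpm hpi hp1 hq0 hqm hOm hpO
    hM2i hT1i hT2i hc hwt (hasLaw_sqrt_mul_gaussian hZ hsA0)
  have hcltB := selfNormReweighting_clt (P' := P') hym' hind' hlaw' hpm hpi hp1 hq0' hqm' hOm
    hpO hM2i' hT1i' hT2i' hc' hwt' (hasLaw_sqrt_mul_gaussian hZ hsB0)
  -- the printed squared standard errors are strongly consistent
  have hVA := selfNormErrorBar_tendsto_ae hym hind hlaw hpm hpi hp1 hq0 hqm hOm hpO hM2i hT1i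
    hT2i hc hwt
  have hVB := selfNormErrorBar_tendsto_ae hym' hind' hlaw' hpm hpi hp1 hq0' hqm' hOm hpO hM2i'
    hT1i' hT2i' hc' hwt'
  -- measurability of the printed pieces
  have hwtm : Measurable wt := by
    rw [show wt = fun z => c * (p z / q z) from funext hwt]
    exact (hpm.div hqm).const_mul c
  have hwtm' : Measurable wt' := by
    rw [show wt' = fun z => c' * (p z / q' z) from funext hwt']
    exact (hpm.div hqm').const_mul c'
  have hSAm : ∀ n : ℕ, Measurable fun ω : ΩA =>
      (∑ j ∈ range n, wt (y j ω) * O (y j ω)) / (∑ j ∈ range n, wt (y j ω)) := fun n =>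
    (Finset.measurable_sum _ fun j _ => (hwtm.comp (hym j)).mul (hOm.comp (hym j))).div
      (Finset.measurable_sum _ fun j _ => hwtm.comp (hym j))
  have hSBm : ∀ n : ℕ, Measurable fun ω : ΩB =>
      (∑ j ∈ range n, wt' (y' j ω) * O (y' j ω)) / (∑ j ∈ range n, wt' (y' j ω)) := fun n =>
    (Finset.measurable_sum _ fun j _ => (hwtm'.comp (hym' j)).mul (hOm.comp (hym' j))).div
      (Finset.measurable_sum _ fun j _ => hwtm'.comp (hym' j))
  have hVAm : ∀ n : ℕ, Measurable fun ω : ΩA => (∑ i ∈ range n, wt (y i ω) ^ 2 * (O (y i ω)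
      - (∑ j ∈ range n, wt (y j ω) * O (y j ω)) / (∑ j ∈ range n, wt (y j ω))) ^ 2)
        / (∑ i ∈ range n, wt (y i ω)) ^ 2 := fun n =>
    (Finset.measurable_sum _ fun i _ => ((hwtm.comp (hym i)).pow_const 2).mul
      (((hOm.comp (hym i)).sub (hSAm n)).pow_const 2)).div
      ((Finset.measurable_sum _ fun i _ => hwtm.comp (hym i)).pow_const 2)
  have hVBm : ∀ n : ℕ, Measurable fun ω : ΩB => (∑ i ∈ range n, wt' (y' i ω) ^ 2 * (O (y' i ω)
      - (∑ j ∈ range n, wt' (y' j ω) * O (y' j ω)) / (∑ j ∈ range n, wt' (y' j ω))) ^ 2)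
        / (∑ i ∈ range n, wt' (y' i ω)) ^ 2 := fun n =>
    (Finset.measurable_sum _ fun i _ => ((hwtm'.comp (hym' i)).pow_const 2).mul
      (((hOm.comp (hym' i)).sub (hSBm n)).pow_const 2)).div
      ((Finset.measurable_sum _ fun i _ => hwtm'.comp (hym' i)).pow_const 2)
  exact twoSample_agreement_clt (SA := fun n ω =>
      (∑ j ∈ range n, wt (y j ω) * O (y j ω)) / (∑ j ∈ range n, wt (y j ω)))
    (VA := fun n ω => (∑ i ∈ range n, wt (y i ω) ^ 2 * (O (y i ω)
      - (∑ j ∈ range n, wt (y j ω) * O (y j ω)) / (∑ j ∈ range n, wt (y j ω))) ^ 2)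
        / (∑ i ∈ range n, wt (y i ω)) ^ 2)
    (SB := fun n ω => (∑ j ∈ range n, wt' (y' j ω) * O (y' j ω)) / (∑ j ∈ range n, wt' (y' j ω)))
    (VB := fun n ω => (∑ i ∈ range n, wt' (y' i ω) ^ 2 * (O (y' i ω)
      - (∑ j ∈ range n, wt' (y' j ω) * O (y' j ω)) / (∑ j ∈ range n, wt' (y' j ω))) ^ 2)
        / (∑ i ∈ range n, wt' (y' i ω)) ^ 2)
    hsA hsB hSAm hVAm hSBm hVBm hcltA (hasLaw_sqrt_mul_gaussian hZ hsA0) hcltB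
    (hasLaw_sqrt_mul_gaussian hZ hsB0) hVA hVB hm hZ

end Printed

end Summit.Ventures.LatticeQCDFlow.Scoring.CardConsistency

end
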